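import Literature.IUT.HodgeArakelov.GaloisPairCyclotomesThetaSyncGaloisSide
import Literature.AnabelianGeometry.SemiGraphs.TemperedCurveGaloisCyclotomeNatural
import HarnessLib

/-!
# [IUTchII] Cor. 1.11 (b), Galois side of the residual (C′) at Cor. 1.10's genuine family: under (HGAL),
# `μ_Ẑ(quotMap γ)` acts on `μ_Ẑ(Π^tp_{X̲̲}/Δ) ≅ Λ(ℚ̄_pˣ)` by the cyclotomic character of `τ`

Mochizuki, *Inter-universal Teichmüller theory II*, §1, Cor. 1.11 (b), kurims manuscript (Dec. 2020) p. 49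
[claim: Mochizuki2012, status: disputed] (IUTchII §1 Cor 1.11, kurims p.49); *Topics in Absolute Anabelian Geometry III*, Cor. 1.10
(i)(a)/(c) p. 42 [cite: MochizukiAbsTopIII2015, Cor 1.10 (i) p.42]. abc-iut cell, layer L6, node `IUTchII:Cor1.11`; seat
abc-iut-w5-d145 (gen 4), support chain «CW5D145-CONSOLIDATE» piece P2b for GAP-LEDGER **G-w5d145-2**. PROOF-ONLY, 0 defs.

abc-iut-w5-d145 gen 3 (`GaloisPairCyclotomesThetaSyncGaloisSide`, p430955) proved the Galois side of (E): an isomorphism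
`F : μ_Ẑ(Π^tp_{X̲̲}/Δ) ⥲ Λ(ℚ̄_pˣ)` with `Π^tp_{X̲̲}` acting through `aug`. THIS FILE enriches it with the naturality needed for the
residual (C′) ((C′) = `μ_Ẑ(quotMap γ)` vs `ρ_A(γ)` for topological automorphisms `γ` of `Π^tp_{X̲̲}`):
`EtaleLevels.exists_galCyclotome_basePointLim_natural` — `F` may be chosen so that, for every topological automorphism `γ`
of `Π^tp_{X̲̲}` and every `τ ∈ G_{ℚ_p}` with **(HGAL)** `aug(γ x) = τ · aug(x) · τ⁻¹` (abc-iut-w4-d007's hypothesis, p434937: "`γ` lies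
over the inner automorphism `Inn(τ)|_{G_K}`" — the MLF reading of [AbsTopIII] Cor. 1.10), `F(μ_Ẑ(quotMap γ) ζ)_n = τ (F ζ)_n`:
the unit `u₁(γ)` by which `μ_Ẑ(quotMap γ)` acts IS the cyclotomic character of `τ`. Ingredients, all BY NAME: the canonical
`Π/Δ ⥲ G_K` (`AbsTopMonoids.exists_hom_quotObj_base_eq_aug`), which conjugates `quotMap γ` into the outer automorphism
`conj_τ|_{G_K}` of `G_K`; abc-iut-w5-d145's `TemperedCurve.exists_muZhat_GK_mulEquiv_cyclotome_natural` (P2a: LCFT at `ℚ_p` +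
naturality of the open-subgroup invariance of `μ_Ẑ` in compatible pairs, P1). Consequence for G-w5d145-2: under (HGAL) the
residual (C′) at `γ` is a statement about `ρ_A(γ)` alone (P3/P4 of the chain). No new `Prop` fact; nothing of another seat
restated; nothing here bears on [IUTchIII] Cor. 3.12; typed ≠ discharged.
-/

noncomputable section

namespace Literature.IUT.HodgeArakelov

open CategoryTheory
open Literature.AnabelianGeometry.AbsoluteAnabelian

namespace EtaleLevels

open Literature.AnabelianGeometry.EtaleTheta Literature.AnabelianGeometry.SemiGraphs
open scoped Literature.AnabelianGeometry.EtaleTheta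

variable {p : ℕ} [Fact p.Prime] {D : Literature.AnabelianGeometry.EtaleTheta.ThetaSetting p}
  {E : D.EtaleThetaData} {l : ℕ} (C : E.DoubleUnderline l) (hC : D.Compat) (hS : D.Sec2Hyps)
  (hl : l.Prime) (hp2 : p ≠ 2) (hpl : p ≠ l) (hζ : ∃ ζ : D.K, IsPrimitiveRoot ζ (4 * l))
  (mods : ∀ M : ℕ+, D.CyclotomeMod l M)
  (f : contCocycles D.toTheta D.DeltaTheta C.GtpYdduu) (hf : f ∈ C.rootCocycles hC)
  (hmods : ∀ (M M' : ℕ+) (h : (M : ℕ) ∣ (M' : ℕ)) (x : D.lDeltaTheta l),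
    MuN.red p M M' h ((mods M').red x) = (mods M).red x)
  (h15 : Literature.AnabelianGeometry.EtaleTheta.ThetaSetting.Prop15iii E hC) (L : C.CuspLabels)
  (hZ : ∀ M : ℕ+, Nonempty (ModelCyclotomes.lDeltaQuot (C.rigidData (mods M) hC hS h15 L) ≃*
    Literature.IUT.HodgeTheaters.ZHat))

/-- **The GALOIS SIDE of (E) and of (C′), PROVED at the genuine natural system**: for every Ex. 1.8 interface `A` there is
`F : μ_Ẑ(Π^tp_{X̲̲}/Δ) ⥲ Λ(ℚ̄_pˣ)` with (1) `F([x]·ζ)_n = aug(x)((F ζ)_n)` (`Π^tp_{X̲̲}` acts through `aug` — as in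
`exists_galCyclotome_basePointLim_equivariant`) AND (2) for every topological automorphism `γ` of `Π^tp_{X̲̲}` and every
`τ ∈ G_{ℚ_p}` with (HGAL) `aug(γ x) = τ·aug(x)·τ⁻¹`: `F(μ_Ẑ(quotMap γ) ζ)_n = τ((F ζ)_n)` — transporting the group-theoretic
cyclotome of `Π/Δ` along the induced automorphism `quotMap γ` is the field action of `τ` on roots of unity.
[claim: Mochizuki2012, status: disputed] (IUTchII §1 Cor 1.11, kurims p.49) -/
theorem exists_galCyclotome_basePointLim_natural [CompactSpace (setting C hC hS hl hp2 hpl hζ mods f hf).Gk]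
    (A : AbsTopMonoids (setting C hC hS hl hp2 hpl hζ mods f hf)) :
    ∃ F : ↥(A.quotObj (basePointLim C hC hS hl hp2 hpl hζ mods f hf hmods h15 L hZ)).galCyclotome ≃*
        Literature.AnabelianGeometry.EtaleTheta.cyclotome (AlgebraicClosure ℚ_[p])ˣ,
      (∀ (x : (basePointLim C hC hS hl hp2 hpl hζ mods f hf hmods h15 L hZ).G)
        (ζ : (A.quotObj (basePointLim C hC hS hl hp2 hpl hζ mods f hf hmods h15 L hZ)).galCyclotome) (n : ℕ+),
        ((((F (haveI := (A.quotObj (basePointLim C hC hS hl hp2 hpl hζ mods f hf hmods h15 L hZ)).compactSpace_carrier;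
              (QuotientGroup.mk x : _ ⧸ A.Delta _) • ζ) : Literature.AnabelianGeometry.EtaleTheta.cyclotome (AlgebraicClosure ℚ_[p])ˣ) :
              ℕ+ → (AlgebraicClosure ℚ_[p])ˣ) n : (AlgebraicClosure ℚ_[p])ˣ) : AlgebraicClosure ℚ_[p]) =
          (D.aug (Subtype.val x))
            ((((F ζ : Literature.AnabelianGeometry.EtaleTheta.cyclotome (AlgebraicClosure ℚ_[p])ˣ) : ℕ+ → (AlgebraicClosure ℚ_[p])ˣ) n :
              (AlgebraicClosure ℚ_[p])ˣ) : AlgebraicClosure ℚ_[p])) ∧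
      ∀ (γ : basePointLim C hC hS hl hp2 hpl hζ mods f hf hmods h15 L hZ ⟶ basePointLim C hC hS hl hp2 hpl hζ mods f hf hmods h15 L hZ)
        (τ : GQp p)
        (_hγ : ∀ x : (basePointLim C hC hS hl hp2 hpl hζ mods f hf hmods h15 L hZ).G,
          D.aug (Subtype.val (IsoClass.homIso γ x)) = τ * D.aug (Subtype.val x) * τ⁻¹)
        (ζ : (A.quotObj (basePointLim C hC hS hl hp2 hpl hζ mods f hf hmods h15 L hZ)).galCyclotome) (n : ℕ+),
        ((((F (IsoClass.galCyclotomeMap (A.quotMap γ) ζ) :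
              Literature.AnabelianGeometry.EtaleTheta.cyclotome (AlgebraicClosure ℚ_[p])ˣ) :
              ℕ+ → (AlgebraicClosure ℚ_[p])ˣ) n : (AlgebraicClosure ℚ_[p])ˣ) : AlgebraicClosure ℚ_[p]) =
          τ ((((F ζ : Literature.AnabelianGeometry.EtaleTheta.cyclotome (AlgebraicClosure ℚ_[p])ˣ) : ℕ+ → (AlgebraicClosure ℚ_[p])ˣ) n :
              (AlgebraicClosure ℚ_[p])ˣ) : AlgebraicClosure ℚ_[p]) := by
  haveI := t2Space_Gk C hC hS hl hp2 hpl hζ mods f hf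
  haveI : CompactSpace D.toTemperedCurve.GK := TemperedCurve.compactSpace_GK D.toTemperedCurve
  obtain ⟨e, he⟩ := A.exists_hom_quotObj_base_eq_aug
  obtain ⟨g, hg, hgnat⟩ := TemperedCurve.exists_muZhat_GK_mulEquiv_cyclotome_natural D.toTemperedCurve
  haveI := (A.quotObj (basePointLim C hC hS hl hp2 hpl hζ mods f hf hmods h15 L hZ)).compactSpace_carrier
  have he' : ∀ y : (basePointLim C hC hS hl hp2 hpl hζ mods f hf hmods h15 L hZ).G,
      IsoClass.homIso e (QuotientGroup.mk y : _ ⧸ A.Delta (basePointLim C hC hS hl hp2 hpl hζ mods f hf hmods h15 L hZ)) =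
        (setting C hC hS hl hp2 hpl hζ mods f hf).aug y := he
  refine ⟨(IsoClass.galCyclotomeMap e).trans g, fun x ζ n => ?_, fun γ τ hγ ζ n => ?_⟩
  · -- (1): verbatim the gen-3 argument
    have h1 := IsoClass.galCyclotomeMap_smul e
      (QuotientGroup.mk x : _ ⧸ A.Delta (basePointLim C hC hS hl hp2 hpl hζ mods f hf hmods h15 L hZ)) ζ
    rw [he'] at h1
    have h2 := hg ((setting C hC hS hl hp2 hpl hζ mods f hf).aug x) (IsoClass.galCyclotomeMap e ζ) n
    have h4 := congrArg (fun y => ((((g y : Literature.AnabelianGeometry.EtaleTheta.cyclotome (AlgebraicClosure ℚ_[p])ˣ) :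
      ℕ+ → (AlgebraicClosure ℚ_[p])ˣ) n : (AlgebraicClosure ℚ_[p])ˣ) : AlgebraicClosure ℚ_[p])) h1
    exact h4.trans h2
  · -- (2): conjugate `quotMap γ` into an automorphism `ψ` of the reference object `G_K`
    let ψ : IsoClass.base (setting C hC hS hl hp2 hpl hζ mods f hf).Gk ⟶ IsoClass.base (setting C hC hS hl hp2 hpl hζ mods f hf).Gk :=
      inv e ≫ A.quotMap γ ≫ e
    have hcomm : A.quotMap γ ≫ e = e ≫ ψ := (IsIso.hom_inv_id_assoc e (A.quotMap γ ≫ e)).symm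
    have h0 : ∀ t, IsoClass.homIso e (IsoClass.homIso (inv e) t) = t := fun t => by
      change IsoClass.homIso (inv e ≫ e) t = t
      rw [IsIso.inv_hom_id]
      rfl
    -- `ψ (aug y) = aug (γ y)`
    have h1 : ∀ y : (IsoClass.base (setting C hC hS hl hp2 hpl hζ mods f hf).PiX).G,
        IsoClass.homIso ψ ((setting C hC hS hl hp2 hpl hζ mods f hf).aug y) =
          (setting C hC hS hl hp2 hpl hζ mods f hf).aug (IsoClass.homIso γ y) := by
      intro y
      have h2 : IsoClass.homIso (inv e) ((setting C hC hS hl hp2 hpl hζ mods f hf).aug y) =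
          (QuotientGroup.mk y : (IsoClass.base (setting C hC hS hl hp2 hpl hζ mods f hf).PiX).G ⧸
            A.Delta (IsoClass.base (setting C hC hS hl hp2 hpl hζ mods f hf).PiX)) := by
        apply (IsoClass.homIso e).injective
        rw [h0, he]
      exact (congrArg (fun t => IsoClass.homIso e (IsoClass.homIso (A.quotMap γ) t)) h2).trans
        (he (IsoClass.homIso γ y))
    -- `ψ` IS `conj_τ` on underlying elements of `G_K ≤ G_{ℚ_p}` (by (HGAL) and the surjectivity of `aug`)
    have hψ : ∀ σ : D.toTemperedCurve.GK,
        Subtype.val (IsoClass.homIso ψ σ) = τ * (σ : GQp p) * τ⁻¹ := by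
      intro σ
      obtain ⟨y, rfl⟩ := (setting C hC hS hl hp2 hpl hζ mods f hf).aug_surjective σ
      rw [h1 y]
      exact hγ y
    -- `μ_Ẑ(quotMap γ) ≫ μ_Ẑ(e) = μ_Ẑ(e) ≫ μ_Ẑ(ψ)`
    have h3a : (IsoClass.galCyclotomeMap (A.quotMap γ)).trans (IsoClass.galCyclotomeMap e) =
        (IsoClass.galCyclotomeMap e).trans (IsoClass.galCyclotomeMap ψ) := by
      rw [← IsoClass.galCyclotomeMap_comp, ← IsoClass.galCyclotomeMap_comp]
      exact congrArg _ hcomm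
    have h3 : IsoClass.galCyclotomeMap e (IsoClass.galCyclotomeMap (A.quotMap γ) ζ) =
        IsoClass.galCyclotomeMap ψ (IsoClass.galCyclotomeMap e ζ) := MulEquiv.congr_fun h3a ζ
    have h4 := congrArg (fun y => ((((g y : Literature.AnabelianGeometry.EtaleTheta.cyclotome (AlgebraicClosure ℚ_[p])ˣ) :
      ℕ+ → (AlgebraicClosure ℚ_[p])ˣ) n : (AlgebraicClosure ℚ_[p])ˣ) : AlgebraicClosure ℚ_[p])) h3
    have h5 := hgnat τ (IsoClass.homIso ψ) hψ (IsoClass.galCyclotomeMap e ζ) n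
    exact h4.trans h5

end EtaleLevels

end Literature.IUT.HodgeArakelov

end
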